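import Summits.AtomisticToContinuum.BoseEinsteinCondensation.Theorems.BECGroundStateSOSBoundaryTransferWeakHardWallLimitLocallyBoundedAux
import Summits.AtomisticToContinuum.BoseEinsteinCondensation.Theorems.BECGroundStateSOSBoundaryTransferWeakHardWallLimitLocallyBoundedChain

/-!
# Route `BECGroundStateSOS`, crux `BoundaryTransferWeak` (stmt-AtomisticToContinuum-0827),
# line `rim-squeeze-monotone-coherence`: stub (L) `stub_hardWallLimit_locallyBounded`

Supports stmt-AtomisticToContinuum-0827; proves the registered stub
`stub_hardWallLimit_locallyBounded` (lead c3): the hard-wall limit (L) of the rim-squeeze line —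
at fixed large `N`, `limsup_{t → ∞} coreOcc v t N ρ' ≤ coreOcc v ⊤ N ρ'` — for every repulsive
finite-range pair potential that is bounded on every `(δ, ∞)` (soft or integrable singularities at
`r → 0` allowed; hard cores excluded). By the landed `stub_hardWallLimit_aux` this is the
near-minimiser transfer across the hard wall, `hardWallTransfer_of_locallyBounded`, obtained from
the landed rim-cut-off/dilation/modulus chain with a pair-collision cutoff inserted before the
dilation:

* `exists_collisionCutoff` — the parameter choice for the fixed-data cut state
  `stub_hardWallLimit_locallyBounded_aux` (`…LocallyBoundedAux.lean`): for `N ≥ 1`, a reference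
  side `L₀`, an energy ceiling `K₁` and `τ > 0` there is a collision radius `ε₁ > 0` such that every
  Dirichlet state of a cube of side `≤ L₀` with energy `≤ K₁` is `τ`-close (energy from above and
  `L²`) to a state supported off the `ε₁`-neighbourhood of the collision set;
* `exists_hardWall_params_locBdd` — the choice of the rim width `h` (continuity at `h = 0` of the
  error terms of `transfer_chain_locBdd`, `…LocallyBoundedChain.lean`);
* `hardWallTransfer_of_locallyBounded`, `stub_hardWallLimit_locallyBounded`.

All `[folklore]` (Simon's monotone convergence for `H_t ↑ H_⊤` made quantitative; LSSY Thm 2.4 for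
the collision cutoff).
-/

noncomputable section

namespace Summit.AtomisticToContinuum.BoseEinsteinCondensation.RimSqueeze

open Literature.MathematicalPhysics.QuantumManyBody.BoseGas
open MeasureTheory Filter Set Topology
open scoped ENNReal NNReal ComplexConjugate
open Summit.AtomisticToContinuum.BoseEinsteinCondensation.Theorems.GroundStateRigidity
  (stub_pairCutoff stub_truncHigh groundStateEnergy_ne_top_of_locBdd)

variable {N : ℕ}

/-! ### The pair-collision cutoff: parameter choice -/

/-- **Pair-collision cutoff of bounded-energy Dirichlet states, for pair potentials bounded on
every `(δ, ∞)`.** For `N ≥ 1`, a reference side `L₀`, an energy ceiling `K₁` and `τ > 0` there is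
a collision radius `ε₁ > 0` such that every Dirichlet trial state `Φ` of any cube of side
`ℓ ≤ L₀` with `energy v Φ ≤ K₁` is within `τ` (energy, from above) and `τ` (`L²` distance squared)
of a trial state `Θ` of the same cube supported off the `ε₁`-neighbourhood of the collision set
(parameters `θ, ρ, ηt, B, ε₁, χ, Cv, n` chosen in this order for
`stub_hardWallLimit_locallyBounded_aux`). [cite: LSSY2005, proof of Thm 2.4] -/
theorem exists_collisionCutoff (hN : 1 ≤ N) {L₀ : ℝ} (hL₀ : 0 < L₀) {v : ℝ → ℝ≥0∞}
    (hvm : Measurable v)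
    (hlb : ∀ δ : ℝ, 0 < δ → ∃ M : ℝ≥0∞, M ≠ ⊤ ∧ ∀ r : ℝ, δ < r → v r ≤ M)
    {K₁ : ℝ} (hK₁ : 0 ≤ K₁) {τ : ℝ} (hτ : 0 < τ) :
    ∃ ε₁ : ℝ, 0 < ε₁ ∧ ∀ ℓ : ℝ, ℓ ≤ L₀ → ∀ Φ : TrialState N ℓ,
      energy v Φ ≤ ENNReal.ofReal K₁ →
      ∃ Θ : TrialState N ℓ, energy v Θ ≤ energy v Φ + ENNReal.ofReal τ ∧
        ∫⁻ X, (‖Θ.ψ X - Φ.ψ X‖₊ : ℝ≥0∞) ^ 2 ≤ ENNReal.ofReal τ ∧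
        ∀ X, Θ.ψ X ≠ 0 → ∀ i j : Fin N, i ≠ j → ε₁ < dist (X i) (X j) := by
  obtain ⟨A, hA⟩ := stub_pairCutoff N L₀ hL₀
  -- parameters `θ`, `ρ`, `ηt`, `B`, `ε₁`, `χ`, `Cv`, `n`, in this order
  set κ : ℝ := τ / (64 * (K₁ + 1)) with hκ_def
  have hκ0 : 0 < κ := by positivity
  have hκP : κ * (K₁ + 1) = τ / 64 := by rw [hκ_def]; field_simp
  have hκK : κ * K₁ ≤ τ / 64 := by nlinarith
  have hκτ : κ ≤ τ / 64 := by nlinarith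
  set θ : ℝ := min (1 / 2) κ with hθ_def
  have hθ0 : 0 < θ := lt_min (by norm_num) hκ0
  have hθ1 : θ ≤ 1 := (min_le_left _ _).trans (by norm_num)
  have hθκ : θ ≤ κ := min_le_right _ _
  have hθK : 3 * θ * K₁ ≤ τ / 8 := by nlinarith
  have hθτ : 3 * θ ≤ τ / 8 := by linarith
  set ρ : ℝ := min (1 / 16) κ with hρ_def
  have hρ0 : 0 < ρ := lt_min (by norm_num) hκ0
  have hρ1 : ρ ≤ 1 / 16 := min_le_left _ _
  have hρκ : ρ ≤ κ := min_le_right _ _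
  have hρK : ρ * K₁ ≤ τ / 64 := by nlinarith
  have hM : 0 < 1 + θ⁻¹ := by positivity
  set η' : ℝ := ρ / (1 + θ⁻¹) with hη'_def
  have hη'0 : 0 < η' := by positivity
  have hη'ρ : (1 + θ⁻¹) * η' = ρ := by rw [hη'_def]; field_simp
  obtain ⟨B, hB⟩ := stub_truncHigh N hN (Real.toNNReal K₁) η' hη'0
  have hBA : 0 ≤ (B : ℝ) ^ 2 * A := by positivity
  set ε₁ : ℝ := min 1 (ρ / ((1 + θ⁻¹) * ((B : ℝ) ^ 2 * A + 1))) with hε_def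
  have hε0 : 0 < ε₁ := lt_min one_pos (by positivity)
  have hε1 : ε₁ ≤ 1 := min_le_left _ _
  have hXρ : (1 + θ⁻¹) * ((B : ℝ) ^ 2 * A * ε₁) ≤ ρ := by
    have h1 : ε₁ ≤ ρ / ((1 + θ⁻¹) * ((B : ℝ) ^ 2 * A + 1)) := min_le_right _ _
    rw [le_div_iff₀ (by positivity)] at h1
    nlinarith [mul_nonneg hM.le hε0.le]
  obtain ⟨χ, hχ1, hχ01, hχσ, hχ0, -, hχvol, hχkin⟩ := hA ε₁ hε0 hε1
  obtain ⟨C, hCtop, hC⟩ := hlb (ε₁ / 2) (half_pos hε0)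
  have hCC' : (C.toNNReal : ℝ≥0∞) = C := ENNReal.coe_toNNReal hCtop
  have hC' : ∀ s : ℝ, ε₁ ≤ s → v s ≤ C.toNNReal := fun s hs => by
    rw [hCC']
    exact hC s (by linarith)
  obtain ⟨n, hn⟩ := exists_nat_ge (C.toNNReal : ℝ)
  have hCn : (C.toNNReal : ℝ≥0∞) ≤ (n : ℝ≥0∞) := by exact_mod_cast hn
  exact ⟨ε₁, hε0, fun ℓ hℓ Φ hΦ => stub_hardWallLimit_locallyBounded_aux hℓ hvm hK₁ hτ hθ0 hθ1 hθK
    hθτ hη'0 hη'ρ.le hXρ hρ1 (hρκ.trans hκτ) hρK hε0.le hB hχ1 hχ01 hχσ hχ0 hχvol hχkin hC' hCn Φ hΦ⟩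

/-! ### The choice of the rim width -/

/-- **Choice of the small parameter.** For `0 < d ≤ 1 ≤ K` and `0 ≤ τ ≤ d/8`, `τ < ε`,
some `h ∈ (0, min(L/16, 1/2)]` makes the energy error of `transfer_chain_locBdd` `< d`, its
distance error `< ε` and `k₁ ≤ 2K` (all error terms are continuous in `h`; at `h = 0` they are
`ηK + (1+η)δr + τ = d/16 + (1 + d/(16K)) d/4 + τ < d`, `τ < ε` and `(1+η)K < 2K`). [folklore] -/
theorem exists_hardWall_params_locBdd (N : ℕ) {L K c₀ d ε τ : ℝ} (Mr : ℝ) (hL : 0 < L)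
    (hK : 1 ≤ K) (hd : 0 < d) (hd1 : d ≤ 1) (hτ0 : 0 ≤ τ) (hτd : τ ≤ d / 8) (hτε : τ < ε) :
    ∃ h : ℝ, 0 < h ∧ 16 * h < L ∧ h ≤ 1 / 2 ∧
      ∀ η δr σ a₁ p₁ q₁ k₁ b₃ b₂ : ℝ, η = d / (16 * K) → δr = d / 4 → σ = 1 + 8 * h / L →
        a₁ = 1 + 2 * h ^ 3 → p₁ = a₁ * (1 + η) → q₁ = a₁ * (1 + η⁻¹) * (12 * c₀ ^ 2 * h) →
        k₁ = p₁ * K + q₁ →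
        b₃ = 6 * N * (σ - 1) + 18 * N * (σ - 1) ^ 2 * (L / 2 + 4 * h) ^ 2 * (k₁ + τ) →
        b₂ = 36 * N * h ^ 2 * K →
        (σ ^ 2 * p₁ - 1) * K + σ ^ 2 * p₁ * δr + σ ^ 2 * (q₁ + τ) +
            2 * (N * N) * Mr * Real.sqrt b₃ < d ∧
          (Real.sqrt b₃ + Real.sqrt τ + Real.sqrt (4 * h ^ 3) + Real.sqrt b₂) ^ 2 < ε ∧
          k₁ ≤ 2 * K := by
  -- adapted from `exists_hardWall_params` (…HardWallLimitBounded)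
  set η : ℝ := d / (16 * K) with hη
  set δr : ℝ := d / 4 with hδr
  -- the error terms as functions of `h`
  set kf : ℝ → ℝ := fun h =>
    (1 + 2 * h ^ 3) * (1 + η) * K + (1 + 2 * h ^ 3) * (1 + η⁻¹) * (12 * c₀ ^ 2 * h) with hkf
  set F : ℝ → ℝ := fun h =>
    ((1 + 8 * h / L) ^ 2 * ((1 + 2 * h ^ 3) * (1 + η)) - 1) * K +
      (1 + 8 * h / L) ^ 2 * ((1 + 2 * h ^ 3) * (1 + η)) * δr +
      (1 + 8 * h / L) ^ 2 * ((1 + 2 * h ^ 3) * (1 + η⁻¹) * (12 * c₀ ^ 2 * h) + τ) +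
      2 * (N * N) * Mr * Real.sqrt (6 * N * (1 + 8 * h / L - 1) +
        18 * N * (1 + 8 * h / L - 1) ^ 2 * (L / 2 + 4 * h) ^ 2 * (kf h + τ))
    with hF
  set G : ℝ → ℝ := fun h =>
    (Real.sqrt (6 * N * (1 + 8 * h / L - 1) +
        18 * N * (1 + 8 * h / L - 1) ^ 2 * (L / 2 + 4 * h) ^ 2 * (kf h + τ)) +
      Real.sqrt τ + Real.sqrt (4 * h ^ 3) + Real.sqrt (36 * N * h ^ 2 * K)) ^ 2 with hG
  have hkc : Continuous kf := by
    rw [hkf]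
    fun_prop
  have hFc : Continuous F := by
    rw [hF]
    fun_prop
  have hGc : Continuous G := by
    rw [hG]
    fun_prop
  have hK0 : 0 < K := by linarith
  have hk0 : kf 0 < 2 * K := by
    have e : kf 0 = (1 + η) * K := by
      rw [hkf]
      simp
    rw [e, hη]
    have h1 : (1 + d / (16 * K)) * K = K + d / 16 := by field_simp
    rw [h1]
    linarith
  have hF0 : F 0 < d := by
    have e : F 0 = η * K + (1 + η) * δr + τ := by
      rw [hF]
      simp
    rw [e, hη, hδr]
    have h1 : d / (16 * K) * K = d / 16 := by field_simp
    have h2 : d / (16 * K) ≤ 1 / 16 := by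
      rw [div_le_div_iff₀ (by positivity) (by norm_num)]
      nlinarith
    rw [h1]
    nlinarith
  have hG0 : G 0 < ε := by
    have e : G 0 = τ := by
      rw [hG]
      simp [Real.sq_sqrt hτ0]
    rwa [e]
  -- eventually near `0⁺` all constraints hold
  have hr : 0 < min (L / 16) (1 / 2) := lt_min (by positivity) (by norm_num)
  have hev : ∀ᶠ h in 𝓝[>] (0 : ℝ), F h < d ∧ G h < ε ∧ kf h < 2 * K ∧
      h ∈ Ioo 0 (min (L / 16) (1 / 2)) := by
    have h1 : ∀ᶠ h in 𝓝 (0 : ℝ), F h < d := (hFc.tendsto 0).eventually_lt_const hF0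
    have h2 : ∀ᶠ h in 𝓝 (0 : ℝ), G h < ε := (hGc.tendsto 0).eventually_lt_const hG0
    have h3 : ∀ᶠ h in 𝓝 (0 : ℝ), kf h < 2 * K := (hkc.tendsto 0).eventually_lt_const hk0
    exact ((((h1.and h2).and h3).filter_mono nhdsWithin_le_nhds).and (Ioo_mem_nhdsGT hr)).mono
      fun x hx => ⟨hx.1.1.1, hx.1.1.2, hx.1.2, hx.2⟩
  obtain ⟨h, hFh, hGh, hkh, hh0, hhr⟩ := hev.exists
  have hhL : h < L / 16 := hhr.trans_le (min_le_left _ _)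
  have hh2 : h < 1 / 2 := hhr.trans_le (min_le_right _ _)
  refine ⟨h, hh0, by linarith, hh2.le, ?_⟩
  rintro η' δr' σ a₁ p₁ q₁ k₁ b₃ b₂ rfl rfl rfl rfl rfl rfl rfl rfl rfl
  exact ⟨hFh, hGh, hkh.le⟩

/-! ### The transfer and the stub -/

/-- **Near-minimiser transfer across the hard wall for pair potentials bounded on every
`(δ, ∞)`** — the third hypothesis of `stub_hardWallLimit_aux`, at every density (`ρ₁ = 1` is
nominal), eventually in `N`: with `L = sideLength ρ' N`, for every Dirichlet slack `δ' > 0` and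
`ε > 0` there are `t₀` and `δ₀ > 0` such that every `δ₀`-near-minimiser of `H_t`, `t₀ ≤ t ≤ ⊤`, is
within `ε` in `L²` of a `δ'`-near-minimiser of the Dirichlet cube of side `L/2`. Rim cut-off,
pair-collision cutoff (`exists_collisionCutoff`), dilation off the collision set and `L²` moduli
(`transfer_chain_locBdd`), with the rim width chosen by `exists_hardWall_params_locBdd`.
[folklore] -/
theorem hardWallTransfer_of_locallyBounded : ∀ v : ℝ → ℝ≥0∞, IsRepulsiveFiniteRange v →
    (∀ δ : ℝ, 0 < δ → ∃ M : ℝ≥0∞, M ≠ ⊤ ∧ ∀ r : ℝ, δ < r → v r ≤ M) →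
    ∃ ρ₁ : ℝ, 0 < ρ₁ ∧ ∀ ρ' : ℝ, 0 < ρ' → ρ' < ρ₁ → ∀ᶠ N : ℕ in atTop,
      ∀ δ' : ℝ≥0∞, 0 < δ' → ∀ ε : ℝ, 0 < ε → ∃ t₀ : ℝ≥0, ∃ δ₀ : ℝ≥0∞, 0 < δ₀ ∧
        ∀ t : ℝ≥0∞, (t₀ : ℝ≥0∞) ≤ t → ∀ Ψ : PeriodicTrialState N (sideLength ρ' N),
          rampEnergy v (rimPot (sideLength ρ' N)) t Ψ ≤
              rampGroundStateEnergy v (rimPot (sideLength ρ' N)) t N (sideLength ρ' N) + δ₀ →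
          ∃ Φ : TrialState N (sideLength ρ' N / 2),
            energy v Φ ≤ groundStateEnergy v N (sideLength ρ' N / 2) + δ' ∧
            ∫⁻ X, (‖Φ.ψ X - (cellN N (sideLength ρ' N)).indicator Ψ.ψ X‖₊ : ℝ≥0∞) ^ 2 ≤
              ENNReal.ofReal ε := by
  -- adapted from `hardWallTransfer_of_bounded` (…HardWallLimitBounded)
  rintro v hv hlb
  obtain ⟨R, hR0, hvR⟩ := hv.exists_pos_range
  obtain ⟨c₀, -, hprof⟩ := exists_isCutoffProfile
  refine ⟨1, one_pos, fun ρ' hρ' _ => ?_⟩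
  filter_upwards [eventually_ge_atTop 1, (tendsto_sideLength_atTop hρ').eventually_ge_atTop (2 * R)]
    with N hN hNR
  set L : ℝ := sideLength ρ' N with hLdef
  have hL : 0 < L := sideLength_pos_of_pos hρ' hN
  have hRL : L / 2 + R ≤ L := by linarith
  have hlb' : ∀ r : ℝ, 0 < r → ∃ C : ℝ≥0, ∀ s : ℝ, r ≤ s → v s ≤ C := by
    intro r hr
    obtain ⟨M, hM, hb⟩ := hlb (r / 2) (half_pos hr)
    exact ⟨M.toNNReal, fun s hs => (hb s (by linarith)).trans (ENNReal.coe_toNNReal hM).ge⟩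
  have hE : groundStateEnergy v N (L / 2) ≠ ⊤ :=
    groundStateEnergy_ne_top_of_locBdd N v _ hN (half_pos hL) hv.1 hlb'
  intro δ' hδ' ε hε
  -- the real slack `d = min δ' 1`, the energy scale `K = E₀^D + 1`, the cutoff slack `τ`
  set δ₁ : ℝ≥0∞ := min δ' 1 with hδ₁
  have hδ₁top : δ₁ ≠ ⊤ := ne_top_of_le_ne_top ENNReal.one_ne_top (min_le_right _ _)
  have hδ₁0 : δ₁ ≠ 0 := (lt_min hδ' one_pos).ne'
  set d : ℝ := δ₁.toReal with hd_def
  have hd : 0 < d := ENNReal.toReal_pos hδ₁0 hδ₁top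
  have hd1 : d ≤ 1 := by
    have := ENNReal.toReal_mono ENNReal.one_ne_top (min_le_right δ' 1)
    rwa [ENNReal.toReal_one] at this
  have hdδ : ENNReal.ofReal d ≤ δ' := by
    rw [hd_def, ENNReal.ofReal_toReal hδ₁top]
    exact min_le_left _ _
  set K : ℝ := (groundStateEnergy v N (L / 2)).toReal + 1 with hKdef
  have hK1 : 1 ≤ K := by rw [hKdef]; linarith [ENNReal.toReal_nonneg (a := groundStateEnergy v N (L / 2))]
  have hK0 : 0 ≤ K := by linarith
  have hKE : groundStateEnergy v N (L / 2) + 1 ≤ ENNReal.ofReal K := by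
    rw [hKdef, ENNReal.ofReal_add ENNReal.toReal_nonneg zero_le_one, ENNReal.ofReal_toReal hE,
      ENNReal.ofReal_one]
  set τ : ℝ := min (d / 8) (ε / 2) with hτdef
  have hτ0 : 0 < τ := lt_min (by positivity) (by positivity)
  have hτd : τ ≤ d / 8 := min_le_left _ _
  have hτε : τ < ε := (min_le_right _ _).trans_lt (by linarith)
  -- the collision radius and the bound of `v` off it
  obtain ⟨ε₁, hε₁, hcut⟩ := exists_collisionCutoff hN hL hv.1 hlb (by positivity : (0 : ℝ) ≤ 2 * K) hτ0
  obtain ⟨C, hC, hvC⟩ := hlb (ε₁ / 2) (half_pos hε₁)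
  -- the small parameter
  obtain ⟨h, hh, h16, hhalf, hP⟩ :=
    exists_hardWall_params_locBdd N (c₀ := c₀) C.toReal hL hK1 hd hd1 hτ0.le hτd hτε
  have h8 : 8 * h < L := by linarith
  set η : ℝ := d / (16 * K) with hη
  have hη0 : 0 < η := by rw [hη]; positivity
  set T₀ : ℝ := K / h ^ 3 with hT₀
  have hT₀0 : 0 < T₀ := by rw [hT₀]; positivity
  refine ⟨Real.toNNReal T₀, ENNReal.ofReal (d / 4), ENNReal.ofReal_pos.2 (by positivity), ?_⟩
  intro t ht Ψ hΨ
  -- the chain at these parameters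
  have hμ : h ^ 3 ≤ 1 / 2 := by nlinarith [pow_le_pow_left₀ hh.le hhalf 3]
  have hKT : K ≤ h ^ 3 * T₀ := by rw [hT₀]; field_simp; exact le_rfl
  have hq : (1 + 2 * h ^ 3) * (1 + η⁻¹) * (c₀ / (h / 2)) ^ 2 * (3 * h ^ 3) =
      (1 + 2 * h ^ 3) * (1 + η⁻¹) * (12 * c₀ ^ 2 * h) := by
    field_simp
    ring
  obtain ⟨hEd, hDε, hk2⟩ := hP η (d / 4) _ _ _ _ _ _ _ rfl rfl rfl rfl rfl rfl rfl rfl rfl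
  have hℓL : L / 2 + 4 * h ≤ L := by linarith
  obtain ⟨Φ, hΦE, hΦd⟩ := transfer_chain_locBdd (N := N) hL hv.1 hC hε₁.le hvC hvR hRL hprof hKE
    hK0 hh h8 hη0 (by positivity : (0 : ℝ) ≤ h ^ 3) hμ (by positivity : (0 : ℝ) ≤ d / 4)
    (by linarith) hT₀0 hKT hτ0.le rfl rfl rfl rfl hq.symm rfl hk2 rfl rfl
    (hcut (L / 2 + 4 * h) hℓL) ht Ψ hΨ
  refine ⟨Φ, hΦE.trans ?_, hΦd.trans (ENNReal.ofReal_le_ofReal hDε.le)⟩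
  gcongr
  exact (ENNReal.ofReal_le_ofReal hEd.le).trans hdδ

/-- **Stub (L) of line `rim-squeeze-monotone-coherence` for the locally bounded class**: for
`v` repulsive, finite-range and bounded on every `(δ, ∞)`, at fixed `N` (large),
`limsup_{t → ∞} coreOcc v t N ρ' ≤ coreOcc v ⊤ N ρ'`. From `stub_hardWallLimit_aux` (Dirichlet
rigidity and finiteness of stmt-9072 + the soft assembly) and
`hardWallTransfer_of_locallyBounded`. [folklore] -/
theorem stub_hardWallLimit_locallyBounded : ∀ v : ℝ → ℝ≥0∞, IsRepulsiveFiniteRange v → (∀ δ : ℝ, 0 < δ → ∃ M : ℝ≥0∞, M ≠ ⊤ ∧ ∀ r : ℝ, δ < r → v r ≤ M) → ∃ ρ₁ : ℝ, 0 < ρ₁ ∧ ∀ ρ' : ℝ, 0 < ρ' → ρ' < ρ₁ → ∀ᶠ N : ℕ in atTop, ∀ η : ℝ, 0 < η → ∃ t₀ : ℝ≥0, ∀ t : ℝ≥0, t₀ ≤ t → coreOcc v (t : ℝ≥0∞) N ρ' ≤ coreOcc v ⊤ N ρ' + ENNReal.ofReal η :=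
  fun v hv hlb => stub_hardWallLimit_aux v hv hlb (hardWallTransfer_of_locallyBounded v hv hlb)

end Summit.AtomisticToContinuum.BoseEinsteinCondensation.RimSqueeze

end
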